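import Literature.Computability.FineGrained.SchoeningWalk
import Literature.Computability.Complexity.CNF
import HarnessLib

/-!
# Schöning's random walk for k-SAT, II: the algorithm as a function of the coins

Topic `Literature/Computability/FineGrained`, sequel of `SchoeningWalk.lean` and groundwork for
the discharge of `Literature.Computability.FineGrained.schoening` (Schöning, FOCS 1999;
Fomin–Kratsch 2010, Theorem 8.3). This file fixes the *functional specification* of the
stack machine of the sequel — Schöning's algorithm as a deterministic function
`runCoins F k T : List Bool → Bool` of the coin string — and proves about it:

* `satisfiable_of_runCoins` — **one-sided error**: if the run reports success, the clause
  list is satisfiable;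
* `runCoins_prob` — **the success probability**: if the clause list `F` (clauses of width
  `≤ k`, `k ≥ 3`, `n'` distinct variables) is satisfiable, the walk length is
  `T ≥ 6 · 2^k · (n' + 1) + 2` and the coin string holds `t ≥ 4 (2 - 2/k)^{n'}` complete
  blocks, then the run succeeds with probability `> 2/3` (uniformly random coins).

## The specified algorithm (as the machine executes it)

Variables are bit strings (binary indices), an assignment is an association list
`al : List (List Bool × Bool)` read through `valOf al x` ("some entry `(x, true)`"),
flipped by `flipKey`. One *walk* on the coins `c`:

1. `initAssg F c` — scan the literal occurrences of `F` in order; at a variable not yet in the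
   assignment pop one coin (an exhausted coin string reads `false`) and *prepend* the entry;
2. then `T` *lazy steps* (`walkFound F k T`): pop `k` coins `ω` (`takePad`); if the current
   assignment satisfies `F`, record success; otherwise take the first violated clause `C`
   (`firstViolated`) and, if exactly one coin of `ω` is set, at position `i < |C|`
   (`oneHot ω = some i`), flip the variable of the `i`-th literal of `C` (`stepAssg`); in all
   other cases do nothing.

The whole run (`runCoins`): while coins remain, pop one coin and do a walk.

## The probability proof

`runCoins_prob` instantiates the comparison lemma `uniformAvg_hits_ge_hit` of `SchoeningWalk.lean`
with the potential "number of variables on which the assignment differs from a fixed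
satisfying assignment `a*`" (`dist`): from a violated clause `C`, the coin block selecting a
literal of `C` that is true under `a*` decreases the potential (probability `2^{-k}`), at most
`|C| - 1 ≤ k - 1` blocks increase it (probability `≤ (k-1) 2^{-k}`), the others leave it —
Schöning's lazy walk with `K = 2^k`, whence (`schoening_hit_ge`) success probability
`≥ (1/(k-1))^{dist} - 2^{-(n'+1)}` per walk from a given start; averaging over the random
initial assignment (`uniformAvg_rho_pow_mismatches`, `half_add_inv_eq`) gives
`≥ (2 - 2/k)^{-n'} / 2` per walk, and `t` independent walks (`uniformAvg_trialsFail_le`,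
`one_sub_pow_le_third`) fail with probability `< 1/3`.

## References

* U. Schöning, *A probabilistic algorithm for k-SAT and constraint satisfaction problems*,
  FOCS 1999, 410–414. [SchoeningFOCS1999]
* F. V. Fomin, D. Kratsch, *Exact Exponential Algorithms*, Springer 2010, §8.1 (Fig. 8.2
  `random-walk`, Fig. 8.3 `k-sat4`, Lemma 8.1, Theorem 8.3). [FominKratsch2010]
-/

namespace Literature.Computability.FineGrained.Schoening

open Literature.Computability.Complexity Literature.Computability.Cryptography

/-! ### Assignments as association lists -/

/-- Assignments as the machine stores them: association lists from variables (bit strings)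
to values. [folklore] -/
abbrev Assg : Type := List (List Bool × Bool)

/-- The value of `x` under `al`: some entry `(x, true)` is present (absent variables are
`false`). This is what one pass of the machine over the list computes. [folklore] -/
def valOf (al : Assg) (x : List Bool) : Bool := al.any fun e => decide (e.1 = x) && e.2

/-- Whether `x` has an entry in `al`. [folklore] -/
def hasKey (al : Assg) (x : List Bool) : Bool := al.any fun e => decide (e.1 = x)

/-- The variables of `al`, in order. [folklore] -/
def keys (al : Assg) : List (List Bool) := al.map Prod.fst

/-- Flip the value of every entry of `x`. [folklore] -/
def flipKey (al : Assg) (x : List Bool) : Assg :=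
  al.map fun e => if e.1 = x then (e.1, !e.2) else e

/-- `valOf` of a cons. [folklore] -/
@[simp] theorem valOf_cons (e : List Bool × Bool) (al : Assg) (x : List Bool) :
    valOf (e :: al) x = ((decide (e.1 = x) && e.2) || valOf al x) := rfl

/-- `valOf` of the empty list. [folklore] -/
@[simp] theorem valOf_nil (x : List Bool) : valOf [] x = false := rfl

/-- `keys` of a cons. [folklore] -/
@[simp] theorem keys_cons (e : List Bool × Bool) (al : Assg) : keys (e :: al) = e.1 :: keys al := rfl

/-- `keys` of the empty list. [folklore] -/
@[simp] theorem keys_nil : keys ([] : Assg) = [] := rfl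

/-- `hasKey` is membership in `keys`. [folklore] -/
theorem hasKey_eq (al : Assg) (x : List Bool) : hasKey al x = decide (x ∈ keys al) := by
  induction al with
  | nil => simp [hasKey, keys]
  | cons e al ih =>
    simp only [hasKey, List.any_cons] at ih ⊢
    rw [ih, keys_cons, Bool.eq_iff_iff]
    simp only [Bool.or_eq_true, decide_eq_true_eq, List.mem_cons]
    exact or_congr_left eq_comm

/-- Flipping does not change the variables. [folklore] -/
@[simp] theorem keys_flipKey (al : Assg) (x : List Bool) : keys (flipKey al x) = keys al := by
  induction al with
  | nil => rfl
  | cons e al ih =>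
    simp only [flipKey, List.map_cons, keys_cons] at ih ⊢
    rw [ih]
    split_ifs <;> rfl

/-- A variable without entry has value `false`. [folklore] -/
theorem valOf_of_not_mem {al : Assg} {x : List Bool} (h : x ∉ keys al) : valOf al x = false := by
  induction al with
  | nil => rfl
  | cons e al ih =>
    simp only [keys_cons, List.mem_cons, not_or] at h
    rw [valOf_cons, ih h.2, decide_eq_false (Ne.symm h.1)]
    rfl

/-- Flipping a variable without entry does nothing. [folklore] -/
theorem flipKey_of_not_mem {al : Assg} {x : List Bool} (h : x ∉ keys al) : flipKey al x = al := by
  induction al with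
  | nil => rfl
  | cons e al ih =>
    simp only [keys_cons, List.mem_cons, not_or] at h
    simp only [flipKey, List.map_cons] at ih ⊢
    rw [ih h.2, if_neg (Ne.symm h.1)]

/-- **Flipping `x` negates the value of `x` and keeps the others**, provided `x` has exactly
one entry (the variables of `al` are distinct and contain `x`). [folklore] -/
theorem valOf_flipKey {al : Assg} (hnd : (keys al).Nodup) {x : List Bool} (hx : x ∈ keys al)
    (y : List Bool) : valOf (flipKey al x) y = if y = x then !valOf al x else valOf al y := by
  induction al with
  | nil => simp at hx
  | cons e al ih =>
    rw [keys_cons, List.nodup_cons] at hnd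
    rw [keys_cons, List.mem_cons] at hx
    by_cases hex : e.1 = x
    · -- the entry of `x` is the head; `x` does not occur in the tail
      have hxt : x ∉ keys al := hex ▸ hnd.1
      have h1 : flipKey (e :: al) x = (e.1, !e.2) :: al := by
        simp only [flipKey, List.map_cons, if_pos hex]
        exact congrArg _ (flipKey_of_not_mem hxt)
      rw [h1]
      by_cases hy : y = x
      · subst hy
        simp [valOf_of_not_mem hxt, hex]
      · have hey : ¬ e.1 = y := fun h => hy (h.symm.trans hex)
        simp [hy, hey]
    · have hx' : x ∈ keys al := hx.resolve_left (Ne.symm hex)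
      have h1 : flipKey (e :: al) x = e :: flipKey al x := by
        simp only [flipKey, List.map_cons, if_neg hex]
      rw [h1, valOf_cons, valOf_cons, ih hnd.2 hx']
      by_cases hy : y = x
      · subst hy
        simp [hex]
      · simp [hy]

/-! ### Clauses under an assignment; one lazy step -/

/-- The assignment `al` satisfies the clause list `F`. [folklore] -/
def good (F : CNF (List Bool)) (al : Assg) : Bool := F.eval (valOf al)

/-- The first clause of `F` violated by `al`, if any. [folklore] -/
def firstViolated (F : CNF (List Bool)) (al : Assg) : Option (Clause (List Bool)) :=
  F.find? fun c => !(Clause.eval (valOf al) c)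

/-- No violated clause iff the assignment is good. [folklore] -/
theorem firstViolated_eq_none_iff (F : CNF (List Bool)) (al : Assg) :
    firstViolated F al = none ↔ good F al = true := by
  rw [firstViolated, List.find?_eq_none, good, CNF.eval_eq_true_iff]
  refine forall₂_congr fun c _ => ?_
  simp

/-- A first violated clause is a clause of `F`, violated. [folklore] -/
theorem mem_of_firstViolated {F : CNF (List Bool)} {al : Assg} {C : Clause (List Bool)}
    (h : firstViolated F al = some C) : C ∈ F ∧ Clause.eval (valOf al) C = false := by
  refine ⟨List.mem_of_find?_eq_some h, ?_⟩
  have := List.find?_some h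
  simpa using this

/-- `oneHot ω = some i` iff exactly one coin of `ω` is set, the `i`-th. [folklore] -/
def oneHot : List Bool → Option ℕ
  | [] => none
  | true :: w => if w.all (fun b => !b) then some 0 else none
  | false :: w => (oneHot w).map Nat.succ

/-- The coin block selecting position `i`: `k` coins, exactly the `i`-th set. [folklore] -/
def oneHotVec (k i : ℕ) : List Bool := (List.range k).map fun j => decide (j = i)

/-- `oneHotVec k i` has length `k`. [folklore] -/
@[simp] theorem length_oneHotVec (k i : ℕ) : (oneHotVec k i).length = k := by
  simp [oneHotVec]

/-- `oneHotVec (k+1) 0 = true :: (all false)`. [folklore] -/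
theorem oneHotVec_succ_zero (k : ℕ) : oneHotVec (k + 1) 0 = true :: List.replicate k false := by
  rw [oneHotVec, List.range_succ_eq_map, List.map_cons, List.map_map]
  refine congrArg₂ _ (by simp) ?_
  rw [List.eq_replicate_iff]
  refine ⟨by simp, fun b hb => ?_⟩
  obtain ⟨j, -, rfl⟩ := List.mem_map.1 hb
  simp

/-- `oneHotVec (k+1) (i+1) = false :: oneHotVec k i`. [folklore] -/
theorem oneHotVec_succ_succ (k i : ℕ) : oneHotVec (k + 1) (i + 1) = false :: oneHotVec k i := by
  rw [oneHotVec, List.range_succ_eq_map, List.map_cons, List.map_map]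
  refine congrArg₂ _ (by simp) ?_
  simp [oneHotVec, Function.comp_def]

/-- `oneHot` recognises `oneHotVec`. [folklore] -/
theorem oneHot_oneHotVec {k i : ℕ} (h : i < k) : oneHot (oneHotVec k i) = some i := by
  induction k generalizing i with
  | zero => omega
  | succ k ih =>
    cases i with
    | zero =>
      rw [oneHotVec_succ_zero, oneHot, if_pos]
      simp
    | succ i =>
      rw [oneHotVec_succ_succ, oneHot, ih (by omega)]
      rfl

/-- Conversely `oneHot ω = some i` forces `ω = oneHotVec |ω| i` with `i < |ω|`. [folklore] -/
theorem eq_oneHotVec_of_oneHot : ∀ {ω : List Bool} {i : ℕ}, oneHot ω = some i →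
    ω = oneHotVec ω.length i ∧ i < ω.length
  | [], i, h => by simp [oneHot] at h
  | true :: w, i, h => by
    simp only [oneHot] at h
    split_ifs at h with hall
    · simp only [Option.some.injEq] at h
      subst h
      refine ⟨?_, by simp⟩
      rw [List.length_cons, oneHotVec_succ_zero]
      refine congrArg _ (List.eq_replicate_iff.2 ⟨rfl, fun b hb => ?_⟩)
      simpa using List.all_eq_true.1 hall b hb
  | false :: w, i, h => by
    simp only [oneHot] at h
    cases hw : oneHot w with
    | none => rw [hw] at h; simp at h
    | some j =>
      rw [hw, Option.map_some, Option.some.injEq] at h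
      subst h
      obtain ⟨h1, h2⟩ := eq_oneHotVec_of_oneHot hw
      refine ⟨?_, by simp; omega⟩
      rw [List.length_cons, Nat.succ_eq_add_one, oneHotVec_succ_succ, ← h1]

/-- The `k` coins of one step: the first `k` coins, padded with `false` if the coin string is
exhausted (an empty coin register reads `false`). [folklore] -/
def takePad (k : ℕ) (c : List Bool) : List Bool := (c ++ List.replicate k false).take k

/-- `takePad k c` has length `k`. [folklore] -/
@[simp] theorem length_takePad (k : ℕ) (c : List Bool) : (takePad k c).length = k := by
  simp [takePad]

/-- With enough coins `takePad` is `take`. [folklore] -/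
theorem takePad_eq_take {k : ℕ} {c : List Bool} (h : k ≤ c.length) : takePad k c = c.take k := by
  rw [takePad, List.take_append_of_le_length h]

/-- With a full block in front, `takePad` returns it. [folklore] -/
theorem takePad_append {k : ℕ} {ω : List Bool} (h : ω.length = k) (w : List Bool) :
    takePad k (ω ++ w) = ω := by
  rw [takePad_eq_take (by simp [h]), List.take_left' h]

/-- **One lazy step** on the coin block `ω`: if some clause is violated, take the first one,
`C`; if exactly one coin is set, at position `i < |C|`, flip the variable of the `i`-th literal
of `C`; otherwise keep the assignment. (Fomin–Kratsch 2010, Fig. 8.2 `random-walk`: "choose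
an arbitrary clause which is not satisfied … choose one variable of this clause uniformly at
random and flip its value"; lazy version.) [cite: FominKratsch2010, Fig. 8.2 (random-walk)] -/
def stepAssg (F : CNF (List Bool)) (al : Assg) (ω : List Bool) : Assg :=
  match firstViolated F al with
  | none => al
  | some C =>
    match oneHot ω with
    | none => al
    | some i =>
      match C[i]? with
      | none => al
      | some l => flipKey al l.1

/-- A step either keeps the assignment or flips the variable of a literal of the first
violated clause. [folklore] -/
theorem stepAssg_eq_or (F : CNF (List Bool)) (al : Assg) (ω : List Bool) :
    stepAssg F al ω = al ∨
      ∃ C, firstViolated F al = some C ∧ ∃ l ∈ C, stepAssg F al ω = flipKey al l.1 := by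
  unfold stepAssg
  split
  · exact Or.inl rfl
  · next C hC =>
    split
    · exact Or.inl rfl
    · next i _ =>
      split
      · exact Or.inl rfl
      · next l hl => exact Or.inr ⟨C, hC, l, List.mem_of_getElem? hl, rfl⟩

/-- A step keeps the variables. [folklore] -/
@[simp] theorem keys_stepAssg (F : CNF (List Bool)) (al : Assg) (ω : List Bool) :
    keys (stepAssg F al ω) = keys al := by
  rcases stepAssg_eq_or F al ω with h | ⟨C, -, l, -, h⟩ <;> rw [h]
  exact keys_flipKey al l.1

/-! ### One walk, the initial assignment, the whole run -/

/-- **The walk of `T` lazy steps** from `al` on the coins `c`: success iff some assignment met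
(before one of the `T` steps) satisfies `F`. (Fomin–Kratsch 2010, Fig. 8.2.)
[cite: FominKratsch2010, Fig. 8.2 (random-walk)] -/
def walkFound (F : CNF (List Bool)) (k : ℕ) : ℕ → Assg → List Bool → Bool
  | 0, _, _ => false
  | T + 1, al, c => good F al || walkFound F k T (stepAssg F al (takePad k c)) (c.drop k)

/-- The literal occurrences of `F` (their variables), in order. [folklore] -/
def occs (F : CNF (List Bool)) : List (List Bool) := F.flatten.map Prod.fst

/-- Building the initial assignment along the occurrences `xs`: a variable already assigned is
skipped, a new one receives the next coin (`false` if none is left), prepended. [folklore] -/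
def initGo : List (List Bool) → Assg → List Bool → Assg × List Bool
  | [], al, c => (al, c)
  | x :: xs, al, c =>
    if hasKey al x then initGo xs al c else initGo xs ((x, c.headD false) :: al) c.tail

/-- **The random initial assignment** of the variables of `F` read off the coins, and the
remaining coins. (Fomin–Kratsch 2010, Fig. 8.3: "choose an assignment uniformly at random".)
[cite: FominKratsch2010, Fig. 8.3 (k-sat4)] -/
def initAssg (F : CNF (List Bool)) (c : List Bool) : Assg × List Bool := initGo (occs F) [] c

/-- `initGo` only consumes coins. [folklore] -/
theorem length_initGo_le : ∀ (xs : List (List Bool)) (al : Assg) (c : List Bool),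
    (initGo xs al c).2.length ≤ c.length
  | [], al, c => le_rfl
  | x :: xs, al, c => by
    unfold initGo
    split_ifs
    · exact length_initGo_le xs al c
    · exact (length_initGo_le xs _ c.tail).trans (by simp)

/-- **The whole run**: while coins remain, pop one and do a walk of `T` steps from a fresh
random initial assignment; success iff some walk succeeds. (Fomin–Kratsch 2010, Fig. 8.3
`k-sat4`, with the number of repetitions governed by the coin supply.)
[cite: FominKratsch2010, Fig. 8.3 (k-sat4)] -/
def runCoins (F : CNF (List Bool)) (k T : ℕ) : List Bool → Bool
  | [] => false
  | _ :: c =>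
    walkFound F k T (initAssg F c).1 (initAssg F c).2 ||
      runCoins F k T ((initAssg F c).2.drop (k * T))
  termination_by c => c.length
  decreasing_by
    have := length_initGo_le (occs F) [] c
    simp only [initAssg, List.length_drop, List.length_cons]
    omega

/-- `runCoins` on an empty coin string. [folklore] -/
@[simp] theorem runCoins_nil (F : CNF (List Bool)) (k T : ℕ) : runCoins F k T [] = false := by
  rw [runCoins]

/-- `runCoins` unrolled once. [folklore] -/
theorem runCoins_cons (F : CNF (List Bool)) (k T : ℕ) (b : Bool) (c : List Bool) :
    runCoins F k T (b :: c) = (walkFound F k T (initAssg F c).1 (initAssg F c).2 ||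
      runCoins F k T ((initAssg F c).2.drop (k * T))) := by
  rw [runCoins]

/-! ### One-sided error -/

/-- A successful walk has met a satisfying assignment. [folklore] -/
theorem exists_good_of_walkFound {F : CNF (List Bool)} {k : ℕ} :
    ∀ {T : ℕ} {al : Assg} {c : List Bool}, walkFound F k T al c = true → ∃ al', good F al' = true
  | 0, _, _, h => by simp [walkFound] at h
  | T + 1, al, c, h => by
    rw [walkFound, Bool.or_eq_true] at h
    rcases h with h | h
    · exact ⟨al, h⟩
    · exact exists_good_of_walkFound h

/-- **One-sided error**: a successful run certifies satisfiability (the machine only ever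
reports assignments it has checked). (Fomin–Kratsch 2010, Theorem 8.3: "If F is not
satisfiable, then the algorithm returns the correct answer".) [cite: FominKratsch2010, Theorem 8.3] -/
theorem satisfiable_of_runCoins {F : CNF (List Bool)} {k T : ℕ} :
    ∀ {c : List Bool}, runCoins F k T c = true → F.Satisfiable
  | [], h => by simp at h
  | b :: c, h => by
    rw [runCoins_cons, Bool.or_eq_true] at h
    rcases h with h | h
    · obtain ⟨al, hal⟩ := exists_good_of_walkFound h
      exact ⟨valOf al, hal⟩
    · exact satisfiable_of_runCoins h
  termination_by c => c.length
  decreasing_by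
    have := length_initGo_le (occs F) [] c
    simp only [initAssg, List.length_drop, List.length_cons]
    omega

/-! ### Reading only a prefix of the coins -/

/-- `takePad` depends only on the first `k` coins. [folklore] -/
theorem takePad_take (k n : ℕ) (w : List Bool) (h : k ≤ n) : takePad k (w.take n) = takePad k w := by
  unfold takePad
  apply List.ext_getElem
  · simp
  · intro i h₁ h₂
    simp only [List.length_take, List.length_append, List.length_replicate] at h₁ h₂
    have hi : i < k := by omega
    rw [List.getElem_take, List.getElem_take]
    by_cases hiw : i < w.length
    · rw [List.getElem_append_left (by simp; omega), List.getElem_append_left hiw, List.getElem_take]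
    · rw [not_lt] at hiw
      rw [List.getElem_append_right (by simp; omega), List.getElem_append_right hiw,
        List.getElem_replicate, List.getElem_replicate]

/-- A walk of `T` steps reads only the first `k · T` coins. [folklore] -/
theorem walkFound_take (F : CNF (List Bool)) (k : ℕ) :
    ∀ (T : ℕ) (al : Assg) (w : List Bool), walkFound F k T al (w.take (k * T)) = walkFound F k T al w
  | 0, _, _ => rfl
  | T + 1, al, w => by
    rw [walkFound, walkFound, takePad_take k _ w (by rw [Nat.mul_succ]; omega)]
    have h2 : (w.take (k * (T + 1))).drop k = (w.drop k).take (k * T) := by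
      rw [List.drop_take]; congr 1; rw [Nat.mul_succ]; omega
    rw [h2, walkFound_take F k T]

/-- With a full supply of coins the walk of `T + 1` steps is `hits T` of the lazy-step process
(`SchoeningWalk.lean`): `T` transitions, `T + 1` assignments checked. [folklore] -/
theorem walkFound_succ_eq_hits (F : CNF (List Bool)) (k : ℕ) :
    ∀ (T : ℕ) (al : Assg) (w : List Bool), k * T ≤ w.length →
      walkFound F k (T + 1) al w = hits (stepAssg F) (good F) k T al w
  | 0, al, w, _ => by simp [walkFound, hits]
  | T + 1, al, w, hw => by
    have hk : k ≤ w.length := by rw [Nat.mul_succ] at hw; omega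
    rw [walkFound, hits_succ, takePad_eq_take hk,
      walkFound_succ_eq_hits F k T _ (w.drop k) (by rw [List.length_drop, Nat.mul_succ] at *; omega)]

/-! ### The discovered variables -/

/-- `disc xs seen`: the elements of `xs` outside `seen`, without repetitions, in order of first
occurrence — the order in which `initGo` discovers new variables. [folklore] -/
def disc : List (List Bool) → List (List Bool) → List (List Bool)
  | [], _ => []
  | x :: xs, seen => if x ∈ seen then disc xs seen else x :: disc xs (x :: seen)

/-- Discovered variables are new. [folklore] -/
theorem not_mem_of_mem_disc : ∀ (xs seen : List (List Bool)) {x : List Bool},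
    x ∈ disc xs seen → x ∉ seen
  | [], _, x, h => by simp [disc] at h
  | y :: xs, seen, x, h => by
    unfold disc at h
    split_ifs at h with hy
    · exact not_mem_of_mem_disc xs seen h
    · rcases List.mem_cons.1 h with rfl | h
      · exact hy
      · exact fun hx => not_mem_of_mem_disc xs (y :: seen) h (List.mem_cons_of_mem _ hx)

/-- Discovered variables are listed once. [folklore] -/
theorem disc_nodup : ∀ (xs seen : List (List Bool)), (disc xs seen).Nodup
  | [], _ => by simp [disc]
  | y :: xs, seen => by
    unfold disc
    split_ifs with hy
    · exact disc_nodup xs seen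
    · exact List.nodup_cons.2 ⟨fun h => not_mem_of_mem_disc xs (y :: seen) h (by simp),
        disc_nodup xs (y :: seen)⟩

/-- Every element is old or discovered. [folklore] -/
theorem mem_disc_of_mem : ∀ (xs seen : List (List Bool)) {x : List Bool},
    x ∈ xs → x ∉ seen → x ∈ disc xs seen
  | [], _, x, h, _ => by simp at h
  | y :: xs, seen, x, h, hs => by
    unfold disc
    split_ifs with hy
    · rcases List.mem_cons.1 h with rfl | h
      · exact (hs hy).elim
      · exact mem_disc_of_mem xs seen h hs
    · rcases List.mem_cons.1 h with rfl | h
      · simp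
      · by_cases hxy : x = y
        · subst hxy; simp
        · exact List.mem_cons_of_mem _ (mem_disc_of_mem xs (y :: seen) h (by simp [hxy, hs]))

/-- At most as many discovered variables as occurrences. [folklore] -/
theorem length_disc_le : ∀ (xs seen : List (List Bool)), (disc xs seen).length ≤ xs.length
  | [], _ => by simp [disc]
  | y :: xs, seen => by
    unfold disc
    split_ifs
    · exact (length_disc_le xs seen).trans (by simp)
    · simpa using length_disc_le xs (y :: seen)

/-- **The distinct variables of `F` in order of first occurrence.** [folklore] -/
def dvars (F : CNF (List Bool)) : List (List Bool) := disc (occs F) []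

/-- The distinct variables are listed once. [folklore] -/
theorem dvars_nodup (F : CNF (List Bool)) : (dvars F).Nodup := disc_nodup _ _

/-- Every variable of every literal of `F` is among `dvars F`. [folklore] -/
theorem mem_dvars {F : CNF (List Bool)} {c : Clause (List Bool)} (hc : c ∈ F)
    {l : Literal (List Bool)} (hl : l ∈ c) : l.1 ∈ dvars F :=
  mem_disc_of_mem _ _ (List.mem_map.2 ⟨l, List.mem_flatten.2 ⟨c, hc, hl⟩, rfl⟩) (by simp)

/-- There are at most as many distinct variables as literal occurrences. [folklore] -/
theorem length_dvars_le (F : CNF (List Bool)) : (dvars F).length ≤ F.flatten.length :=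
  (length_disc_le _ _).trans (by rw [occs, List.length_map])

/-- **What `initGo` computes** (with enough coins): the discovered variables zipped with the
coins, in reverse, prepended to the assignment; the coins beyond are returned. [folklore] -/
theorem initGo_eq : ∀ (xs : List (List Bool)) (al : Assg) (c : List Bool),
    (disc xs (keys al)).length ≤ c.length →
    initGo xs al c =
      (((disc xs (keys al)).zip c).reverse ++ al, c.drop (disc xs (keys al)).length)
  | [], al, c, _ => by simp [initGo, disc]
  | x :: xs, al, c, hlen => by
    unfold initGo
    rw [hasKey_eq]
    by_cases hx : x ∈ keys al
    · rw [decide_eq_true hx]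
      have hd : disc (x :: xs) (keys al) = disc xs (keys al) := by simp [disc, hx]
      rw [hd] at hlen ⊢
      exact initGo_eq xs al c hlen
    · rw [decide_eq_false hx]
      have hd : disc (x :: xs) (keys al) = x :: disc xs (x :: keys al) := by simp [disc, hx]
      rw [hd] at hlen ⊢
      cases c with
      | nil => simp at hlen
      | cons c₀ c' =>
        simp only [Bool.false_eq_true, ↓reduceIte, List.headD_cons, List.tail_cons]
        have h := initGo_eq xs ((x, c₀) :: al) c' (by simpa using hlen)
        rw [keys_cons] at h
        rw [h]
        simp

/-- Zipping ignores the part of the second list beyond the length of the first. [folklore] -/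
theorem zip_append_of_length_le {α β : Type} : ∀ (l₁ : List α) (l₂ r : List β),
    l₁.length ≤ l₂.length → l₁.zip (l₂ ++ r) = l₁.zip l₂
  | [], _, _, _ => by simp
  | _ :: _, [], _, h => by simp at h
  | a :: l₁, b :: l₂, r, h => by
    rw [List.cons_append, List.zip_cons_cons, List.zip_cons_cons,
      zip_append_of_length_le l₁ l₂ r (by simpa using h)]

/-- **The initial assignment with enough coins**: `dvars F` zipped with the first `n'` coins
(reversed), and the remaining coins. [folklore] -/
theorem initAssg_eq (F : CNF (List Bool)) {u : List Bool} (hu : u.length = (dvars F).length)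
    (w : List Bool) : initAssg F (u ++ w) = (((dvars F).zip u).reverse, w) := by
  have h := initGo_eq (occs F) [] (u ++ w) (by simp [dvars, hu])
  rw [keys_nil] at h
  rw [initAssg, h, List.append_nil]
  change (((dvars F).zip (u ++ w)).reverse, (u ++ w).drop (dvars F).length) = _
  rw [zip_append_of_length_le _ _ _ hu.ge, ← hu, List.drop_left]

/-! ### The potential -/

/-- `dist a* ks al`: the number of variables among `ks` on which `al` differs from the
assignment `a*` (in the proof, a fixed satisfying assignment): the Hamming distance of
Fomin–Kratsch 2010, §8.1. [cite: FominKratsch2010, §8.1 (Hamming distance)] -/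
def dist (astar : List Bool → Bool) (ks : List (List Bool)) (al : Assg) : ℕ :=
  (ks.filter fun x => valOf al x != astar x).length

/-- `dist` depends on the assignment only through its values on `ks`. [folklore] -/
theorem dist_congr (astar : List Bool → Bool) {ks : List (List Bool)} {al al' : Assg}
    (h : ∀ x ∈ ks, valOf al x = valOf al' x) : dist astar ks al = dist astar ks al' := by
  unfold dist
  rw [List.filter_congr fun x hx => by rw [h x hx]]

/-- `dist` is at most the number of variables. [folklore] -/
theorem dist_le_length (astar : List Bool → Bool) (ks : List (List Bool)) (al : Assg) :
    dist astar ks al ≤ ks.length :=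
  List.length_filter_le _ _

/-- The distance of a zipped assignment is the number of mismatches of the coins with the
target values (`mismatches` of `SchoeningWalk.lean`). [folklore] -/
theorem dist_zip (astar : List Bool → Bool) : ∀ (ks : List (List Bool)) (cs : List Bool),
    ks.Nodup → ks.length ≤ cs.length →
      dist astar ks (ks.zip cs) = mismatches (ks.map astar) cs
  | [], cs, _, _ => by simp [dist]
  | x :: ks, [], _, h => by simp at h
  | x :: ks, c :: cs, hnd, hlen => by
    rw [List.nodup_cons] at hnd
    rw [List.map_cons, mismatches_cons_cons, List.zip_cons_cons,
      ← dist_zip astar ks cs hnd.2 (by simpa using hlen)]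
    have hkeys : x ∉ keys (ks.zip cs) := by
      rw [keys, List.map_fst_zip (by simpa using hlen)]; exact hnd.1
    unfold dist
    rw [List.filter_cons, valOf_cons, valOf_of_not_mem hkeys]
    have htail : (ks.filter fun y => valOf ((x, c) :: ks.zip cs) y != astar y) =
        ks.filter fun y => valOf (ks.zip cs) y != astar y := by
      refine List.filter_congr fun y hy => ?_
      have hyx : x ≠ y := fun h => hnd.1 (h ▸ hy)
      simp [hyx]
    rw [htail]
    by_cases hc : c = astar x
    · subst hc; simp
    · have : (c != astar x) = true := by simpa using hc
      simp [this, hc]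
      omega

/-- Splitting off the contribution of one variable. [folklore] -/
theorem dist_eq_dist_erase_add (astar : List Bool → Bool) {ks : List (List Bool)} {x : List Bool}
    (hx : x ∈ ks) (al : Assg) :
    dist astar ks al = dist astar (ks.erase x) al + (if valOf al x != astar x then 1 else 0) := by
  unfold dist
  rw [((List.perm_cons_erase hx).filter _).length_eq, List.filter_cons]
  split_ifs <;> simp

/-- **A flip moves the distance by one**: towards `a*` if the flipped variable disagreed with
`a*`, away from it otherwise. [folklore] -/
theorem dist_flipKey (astar : List Bool → Bool) {ks : List (List Bool)} (hks : ks.Nodup)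
    {al : Assg} (hnd : (keys al).Nodup) {x : List Bool} (hx : x ∈ ks) (hxal : x ∈ keys al) :
    dist astar ks (flipKey al x) + (if valOf al x != astar x then 1 else 0) =
      dist astar ks al + (if valOf al x != astar x then 0 else 1) := by
  rw [dist_eq_dist_erase_add astar hx, dist_eq_dist_erase_add astar hx al,
    dist_congr astar (al := flipKey al x) (al' := al) (ks := ks.erase x) (fun y hy => by
      rw [valOf_flipKey hnd hxal, if_neg ((List.Nodup.mem_erase_iff hks).1 hy).1]),
    valOf_flipKey hnd hxal, if_pos rfl]
  cases valOf al x <;> cases astar x <;> simp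

/-- A flip of a listed variable changes the distance by at most one. [folklore] -/
theorem dist_flipKey_le (astar : List Bool → Bool) {ks : List (List Bool)} (hks : ks.Nodup)
    {al : Assg} (hnd : (keys al).Nodup) {x : List Bool} (hx : x ∈ ks) (hxal : x ∈ keys al) :
    dist astar ks (flipKey al x) ≤ dist astar ks al + 1 := by
  have h := dist_flipKey astar hks hnd hx hxal
  split_ifs at h <;> omega

/-- Flipping a variable on which `al` disagrees with `a*` decreases the distance by one.
[folklore] -/
theorem dist_flipKey_of_ne (astar : List Bool → Bool) {ks : List (List Bool)} (hks : ks.Nodup)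
    {al : Assg} (hnd : (keys al).Nodup) {x : List Bool} (hx : x ∈ ks) (hxal : x ∈ keys al)
    (hne : valOf al x ≠ astar x) : dist astar ks (flipKey al x) + 1 = dist astar ks al := by
  have h := dist_flipKey astar hks hnd hx hxal
  have : (valOf al x != astar x) = true := by simpa using hne
  simpa [this] using h

/-! ### Reductions of one step -/

/-- No violated clause: the step keeps the assignment. [folklore] -/
theorem stepAssg_of_none {F : CNF (List Bool)} {al : Assg} (h : firstViolated F al = none)
    (ω : List Bool) : stepAssg F al ω = al := by
  simp [stepAssg, h]

/-- Not exactly one coin set: the step keeps the assignment. [folklore] -/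
theorem stepAssg_of_oneHot_none {F : CNF (List Bool)} {al : Assg} {ω : List Bool}
    (h : oneHot ω = none) : stepAssg F al ω = al := by
  unfold stepAssg
  split
  · rfl
  · simp [h]

/-- Selected position beyond the clause: the step keeps the assignment. [folklore] -/
theorem stepAssg_of_get_none {F : CNF (List Bool)} {al : Assg} {ω : List Bool}
    {C : Clause (List Bool)} (hC : firstViolated F al = some C) {i : ℕ} (hi : oneHot ω = some i)
    (hget : C[i]? = none) : stepAssg F al ω = al := by
  simp [stepAssg, hC, hi, hget]

/-- Selected literal `l`: the step flips its variable. [folklore] -/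
theorem stepAssg_of_get_some {F : CNF (List Bool)} {al : Assg} {ω : List Bool}
    {C : Clause (List Bool)} (hC : firstViolated F al = some C) {i : ℕ} (hi : oneHot ω = some i)
    {l : Literal (List Bool)} (hget : C[i]? = some l) : stepAssg F al ω = flipKey al l.1 := by
  simp [stepAssg, hC, hi, hget]

/-! ### The hypotheses of the comparison lemma -/

section Analysis

variable {F : CNF (List Bool)} {k : ℕ} {astar : List Bool → Bool}

/-- The invariant of the walk: the variables of the assignment are the distinct variables of
`F` (in reverse order of discovery). [folklore] -/
def Inv (F : CNF (List Bool)) (al : Assg) : Prop := keys al = (dvars F).reverse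

/-- The invariant is preserved by steps. [folklore] -/
theorem inv_stepAssg {al : Assg} (h : Inv F al) (ω : List Bool) : Inv F (stepAssg F al ω) := by
  unfold Inv at h ⊢; rw [keys_stepAssg, h]

/-- Under the invariant the variables of the assignment are distinct. [folklore] -/
theorem Inv.nodup {al : Assg} (h : Inv F al) : (keys al).Nodup := by
  rw [h]; exact List.nodup_reverse.2 (dvars_nodup F)

/-- Under the invariant every variable of `F` has an entry. [folklore] -/
theorem Inv.mem_keys {al : Assg} (h : Inv F al) {c : Clause (List Bool)} (hc : c ∈ F)
    {l : Literal (List Bool)} (hl : l ∈ c) : l.1 ∈ keys al := by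
  rw [h, List.mem_reverse]; exact mem_dvars hc hl

/-- **Distance zero is success**: if `al` agrees with the satisfying assignment `a*` on all
variables of `F`, it satisfies `F`. [folklore] -/
theorem good_of_dist_eq_zero (hsat : F.eval astar = true) {al : Assg}
    (hd : dist astar (dvars F) al = 0) : good F al = true := by
  rw [good, CNF.eval_eq_true_iff]
  rw [CNF.eval_eq_true_iff] at hsat
  intro c hc
  have hc' := hsat c hc
  simp only [Clause.eval, List.any_eq_true, Literal.eval, beq_iff_eq] at hc' ⊢
  obtain ⟨l, hl, hal⟩ := hc'
  refine ⟨l, hl, ?_⟩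
  rw [← hal]
  have hmem := mem_dvars hc hl
  unfold dist at hd
  rw [List.length_eq_zero_iff, List.filter_eq_nil_iff] at hd
  have := hd l.1 hmem
  simpa using this

/-- From a violated clause, the good literal and its position: a literal of the first violated
clause that is true under `a*`, hence currently disagreeing with `a*`, at a position `< k`.
[cite: FominKratsch2010, Lemma 8.1 (proof: "The Hamming distance … decreases by one with probability at least 1/k")] -/
theorem exists_good_literal (hsat : F.eval astar = true) (hwidth : ∀ c ∈ F, c.length ≤ k)
    {al : Assg} (hg : good F al = false) :
    ∃ C : Clause (List Bool), firstViolated F al = some C ∧ C ∈ F ∧ C.length ≤ k ∧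
      ∃ (i₀ : ℕ) (l₀ : Literal (List Bool)), C[i₀]? = some l₀ ∧ i₀ < C.length ∧
        valOf al l₀.1 ≠ astar l₀.1 := by
  cases hC : firstViolated F al with
  | none => rw [(firstViolated_eq_none_iff F al).1 hC] at hg; exact absurd hg (by simp)
  | some C =>
    obtain ⟨hCF, hCeval⟩ := mem_of_firstViolated hC
    rw [CNF.eval_eq_true_iff] at hsat
    have h1 := hsat C hCF
    simp only [Clause.eval, List.any_eq_true, Literal.eval, beq_iff_eq] at h1
    obtain ⟨l₀, hl₀, hal₀⟩ := h1
    simp only [Clause.eval, List.any_eq_false, Literal.eval, beq_iff_eq] at hCeval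
    obtain ⟨i₀, hi₀, hget⟩ := List.mem_iff_getElem.1 hl₀
    refine ⟨C, rfl, hCF, hwidth C hCF, i₀, l₀, ?_, hi₀, ?_⟩
    · rw [List.getElem?_eq_getElem hi₀, hget]
    · rw [hal₀]; exact hCeval l₀ hl₀

variable (hsat : F.eval astar = true) (hwidth : ∀ c ∈ F, c.length ≤ k)
include hsat hwidth

omit hsat hwidth in
/-- A step increases the distance by at most one. [folklore] -/
theorem dist_stepAssg_le {al : Assg} (hI : Inv F al) (ω : List Bool) :
    dist astar (dvars F) (stepAssg F al ω) ≤ dist astar (dvars F) al + 1 := by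
  rcases stepAssg_eq_or F al ω with h | ⟨C, hC, l, hl, h⟩
  · rw [h]; omega
  · rw [h]
    have hCF := (mem_of_firstViolated hC).1
    exact dist_flipKey_le astar (dvars_nodup F) hI.nodup (mem_dvars hCF hl) (hI.mem_keys hCF hl)

/-- **The good block**: from a violated state, the block selecting the good literal decreases
the distance, so a decrease has probability at least `2^{-k}`. [cite: FominKratsch2010, Lemma 8.1 (proof)] -/
theorem uniformAvg_down_ge {al : Assg} (hI : Inv F al) (hg : good F al = false) :
    1 / 2 ^ k ≤ uniformAvg k (fun ω => ind (decide (dist astar (dvars F) (stepAssg F al ω) + 1 =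
      dist astar (dvars F) al))) := by
  obtain ⟨C, hC, hCF, hCk, i₀, l₀, hget, hi₀, hne⟩ := exists_good_literal hsat hwidth hg
  refine uniformAvg_ge_of_apply_ge_one (fun _ _ => ind_nonneg _) (length_oneHotVec k i₀) (le_of_eq ?_)
  have hstep : stepAssg F al (oneHotVec k i₀) = flipKey al l₀.1 :=
    stepAssg_of_get_some hC (oneHot_oneHotVec (by omega)) hget
  have hl₀ : l₀ ∈ C := List.mem_of_getElem? hget
  rw [hstep, decide_eq_true (dist_flipKey_of_ne astar (dvars_nodup F) hI.nodup (mem_dvars hCF hl₀)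
    (hI.mem_keys hCF hl₀) hne), ind_true]

/-- **The bad blocks**: from a violated state, the distance increases only on the blocks
selecting another literal of the clause, at most `k - 1` of the `2^k` blocks.
[cite: FominKratsch2010, Lemma 8.1 (proof)] -/
theorem uniformAvg_stay_ge {al : Assg} (hI : Inv F al) (hg : good F al = false) :
    1 - ((k : ℝ) - 1) / 2 ^ k ≤
      uniformAvg k (fun ω => ind (decide (dist astar (dvars F) (stepAssg F al ω) ≤ dist astar (dvars F) al))) := by
  obtain ⟨C, hC, hCF, hCk, i₀, l₀, hget, hi₀, hne⟩ := exists_good_literal hsat hwidth hg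
  set S : Finset ℕ := (Finset.range C.length).erase i₀ with hS
  -- pointwise: off the bad blocks the distance does not increase
  have hpt : ∀ ω : List Bool, ω.length = k →
      1 - ∑ i ∈ S, ind (decide (ω = oneHotVec k i)) ≤
        ind (decide (dist astar (dvars F) (stepAssg F al ω) ≤ dist astar (dvars F) al)) := by
    intro ω hω
    have hsum0 : 0 ≤ ∑ i ∈ S, ind (decide (ω = oneHotVec k i)) :=
      Finset.sum_nonneg fun _ _ => ind_nonneg _
    cases hoh : oneHot ω with
    | none =>
      rw [stepAssg_of_oneHot_none hoh, decide_eq_true le_rfl, ind_true]; linarith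
    | some i =>
      obtain ⟨hωi, hik⟩ := eq_oneHotVec_of_oneHot hoh
      rw [hω] at hωi hik
      cases hgi : C[i]? with
      | none => rw [stepAssg_of_get_none hC hoh hgi, decide_eq_true le_rfl, ind_true]; linarith
      | some l =>
        by_cases hii : i = i₀
        · subst hii
          rw [hget] at hgi
          cases hgi
          rw [stepAssg_of_get_some hC hoh hget]
          have := dist_flipKey_of_ne astar (dvars_nodup F) hI.nodup
            (mem_dvars hCF (List.mem_of_getElem? hget)) (hI.mem_keys hCF (List.mem_of_getElem? hget)) hne
          rw [decide_eq_true (by omega), ind_true]; linarith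
        · have hiS : i ∈ S := by
            rw [hS, Finset.mem_erase, Finset.mem_range]
            exact ⟨hii, (List.getElem?_eq_some_iff.1 hgi).1⟩
          have h1 : ind (decide (ω = oneHotVec k i)) = 1 := by rw [decide_eq_true hωi, ind_true]
          have hge : 1 ≤ ∑ j ∈ S, ind (decide (ω = oneHotVec k j)) := by
            rw [← h1]
            exact Finset.single_le_sum (f := fun j => ind (decide (ω = oneHotVec k j)))
              (fun j _ => ind_nonneg _) hiS
          linarith [ind_nonneg (decide (dist astar (dvars F) (stepAssg F al ω) ≤ dist astar (dvars F) al))]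
  refine le_trans ?_ (uniformAvg_mono hpt)
  rw [uniformAvg_sub, uniformAvg_const, uniformAvg_finset_sum]
  have hterm : ∀ i ∈ S, uniformAvg k (fun ω => ind (decide (ω = oneHotVec k i))) = 1 / 2 ^ k := by
    intro i _
    have h := uniformAvg_ind_eq_single (oneHotVec k i)
    rwa [length_oneHotVec] at h
  rw [Finset.sum_congr rfl hterm, Finset.sum_const, nsmul_eq_mul]
  have hcard : (S.card : ℝ) ≤ (k : ℝ) - 1 := by
    have h1 : S.card = C.length - 1 := by
      rw [hS, Finset.card_erase_of_mem (Finset.mem_range.2 hi₀), Finset.card_range]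
    have h2 : (S.card : ℝ) = (C.length : ℝ) - 1 := by
      rw [h1, Nat.cast_sub (by omega)]; simp
    rw [h2]
    have : (C.length : ℝ) ≤ k := by exact_mod_cast hCk
    linarith
  have hpos : (0 : ℝ) < 1 / 2 ^ k := by positivity
  have := mul_le_mul_of_nonneg_right hcard hpos.le
  rw [div_eq_mul_one_div ((k : ℝ) - 1)]
  linarith

/-- **The walk from a given start**: `hit T (dist al)` bounds the probability that the lazy
walk of `T` transitions from `al` meets a satisfying assignment (comparison lemma with
Schöning's parameters `pd = 2^{-k}`, `ps = 1 - k 2^{-k}`, `pu = (k-1) 2^{-k}`).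
[cite: FominKratsch2010, Lemma 8.1] -/
theorem hit_le_ex_hits (hk : 1 ≤ k) {al : Assg} (hI : Inv F al) (T : ℕ) :
    hit (1 / 2 ^ k) (1 - (k : ℝ) / 2 ^ k) (((k : ℝ) - 1) / 2 ^ k) T (dist astar (dvars F) al) ≤
      uniformAvg (k * T) (fun c => ind (hits (stepAssg F) (good F) k T al c)) := by
  have hk' : (1 : ℝ) ≤ k := by exact_mod_cast hk
  have hK : (k : ℝ) ≤ 2 ^ k := by exact_mod_cast (Nat.lt_two_pow_self).le
  have h2k : (0 : ℝ) < 2 ^ k := by positivity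
  refine uniformAvg_hits_ge_hit (by positivity) ?_ ?_ ?_ (Inv F) (dist astar (dvars F))
    (fun s hs ω _ => inv_stepAssg hs ω) (fun s _ hd => good_of_dist_eq_zero hsat hd)
    (fun s hs _ ω _ => dist_stepAssg_le hs ω)
    (fun s hs hg => uniformAvg_down_ge hsat hwidth hs hg)
    (fun s hs hg => ?_) T al hI
  · rw [sub_nonneg, div_le_one h2k]; exact hK
  · apply div_nonneg <;> linarith
  · field_simp; ring
  · have h := uniformAvg_stay_ge hsat hwidth hs hg
    have e : 1 / (2 : ℝ) ^ k + (1 - (k : ℝ) / 2 ^ k) = 1 - ((k : ℝ) - 1) / 2 ^ k := by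
      field_simp; ring
    rw [e]; exact h

end Analysis

/-! ### The success probability of the run -/

section Prob

variable {F : CNF (List Bool)} {k : ℕ} {astar : List Bool → Bool}
  (hsat : F.eval astar = true) (hwidth : ∀ c ∈ F, c.length ≤ k) (hk : 3 ≤ k)
include hsat hwidth hk

/-- **One walk from a random start succeeds with probability at least `(2 - 2/k)^{-n'} / 2`**
(`n'` = number of distinct variables), for walks of `T' + 1 ≥ 6 · 2^k (n'+1) + 1` steps:
comparison lemma, Schöning's walk bound `schoening_hit_ge`, and the average
`𝔼 (1/(k-1))^{dist} = ((1 + 1/(k-1))/2)^{n'}` over the initial coins.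
[cite: FominKratsch2010, Lemma 8.1] -/
theorem walk_prob {T' : ℕ} (hT : 6 * 2 ^ k * ((dvars F).length + 1) ≤ T') :
    (1 / (2 - 2 / (k : ℝ))) ^ (dvars F).length / 2 ≤
      uniformAvg ((dvars F).length + k * (T' + 1)) (fun c =>
        ind (walkFound F k (T' + 1) (initAssg F c).1 (initAssg F c).2)) := by
  set ks := dvars F with hks
  set n' := ks.length with hn'
  set ρ : ℝ := 1 / ((k : ℝ) - 1) with hρ
  have hk1 : 1 ≤ k := by omega
  -- split the coins into the initial assignment and the steps
  rw [uniformAvg_append]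
  have inner : ∀ u : List Bool, u.length = n' →
      ρ ^ dist astar ks ((ks.zip u).reverse) - 1 / 2 ^ (n' + 1) ≤
        uniformAvg (k * (T' + 1)) (fun w =>
          ind (walkFound F k (T' + 1) (initAssg F (u ++ w)).1 (initAssg F (u ++ w)).2)) := by
    intro u hu
    have hI : Inv F ((ks.zip u).reverse) := by
      unfold Inv keys
      rw [List.map_reverse, List.map_fst_zip (by rw [hu])]
    -- the steps: `walkFound (T'+1) = hits T'` on the first `k T'` coins
    have e1 : uniformAvg (k * (T' + 1)) (fun w =>
        ind (walkFound F k (T' + 1) (initAssg F (u ++ w)).1 (initAssg F (u ++ w)).2)) =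
        uniformAvg (k * T') (fun w => ind (hits (stepAssg F) (good F) k T' ((ks.zip u).reverse) w)) := by
      rw [Nat.mul_succ, uniformAvg_append]
      refine uniformAvg_congr_length fun w hw => ?_
      have : (fun e : List Bool => ind (walkFound F k (T' + 1) (initAssg F (u ++ (w ++ e))).1
          (initAssg F (u ++ (w ++ e))).2)) =
          fun _ => ind (hits (stepAssg F) (good F) k T' ((ks.zip u).reverse) w) := by
        funext e
        rw [initAssg_eq F hu, walkFound_succ_eq_hits F k T' _ _ (by simp [hw]),
          hits_append (stepAssg F) (good F) k T' _ w e hw]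
      rw [this, uniformAvg_const]
    rw [e1]
    refine le_trans ?_ (hit_le_ex_hits hsat hwidth hk1 hI T')
    have h := schoening_hit_ge (K := 2 ^ k) hk (Nat.lt_two_pow_self).le n' (dist astar ks ((ks.zip u).reverse)) hT
    push_cast at h
    exact h
  refine le_trans ?_ (uniformAvg_mono inner)
  rw [uniformAvg_sub, uniformAvg_const]
  -- the average of `ρ ^ dist` over the initial coins
  have e2 : uniformAvg n' (fun u => ρ ^ dist astar ks ((ks.zip u).reverse)) = ((1 + ρ) / 2) ^ n' := by
    have h1 : uniformAvg n' (fun u => ρ ^ dist astar ks ((ks.zip u).reverse)) =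
        uniformAvg n' (fun u => ρ ^ mismatches (ks.map astar) u) := by
      refine uniformAvg_congr_length fun u hu => ?_
      rw [dist_congr astar (al' := ks.zip u) (fun x _ => by simp [valOf, List.any_reverse]),
        dist_zip astar ks u (dvars_nodup F) (by rw [hu])]
    rw [h1, show n' = (ks.map astar).length by simp [hn'], uniformAvg_rho_pow_mismatches]
  rw [e2, hρ, half_add_inv_eq (by omega)]
  -- `2^{-(n'+1)} ≤ (1/(2 - 2/k))^{n'} / 2`
  have hk' : (3 : ℝ) ≤ k := by exact_mod_cast hk
  have hbase : (1 : ℝ) / 2 ≤ 1 / (2 - 2 / (k : ℝ)) := by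
    rw [div_le_div_iff₀ (by norm_num) (by
      have : (2 : ℝ) / k ≤ 1 := by rw [div_le_one (by linarith)]; linarith
      linarith)]
    have : (0 : ℝ) ≤ 2 / k := by positivity
    linarith
  have hpow : (1 : ℝ) / 2 ^ (n' + 1) ≤ (1 / (2 - 2 / (k : ℝ))) ^ n' / 2 := by
    have e : (1 : ℝ) / 2 ^ (n' + 1) = (1 / 2) ^ n' / 2 := by
      rw [one_div_pow, pow_succ, div_div]
    rw [e]
    exact div_le_div_of_nonneg_right (pow_le_pow_left₀ (by norm_num) hbase n') (by norm_num)
  linarith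

/-- The trial of one coin block: drop the wasted first coin, walk from the random initial
assignment read off the block. [folklore] -/
def trialOf (F : CNF (List Bool)) (k T : ℕ) : List Bool → Bool
  | [] => false
  | _ :: c => walkFound F k T (initAssg F c).1 (initAssg F c).2

omit hsat hwidth hk in
/-- **Complete blocks succeed whenever their trials do**: on a coin string holding `t` complete
blocks of `1 + n' + k T` coins, `runCoins` dominates `trials` (they perform the same walks on
the same coins). [folklore] -/
theorem runCoins_of_trials {T : ℕ} : ∀ (t : ℕ) (c : List Bool),
    (1 + (dvars F).length + k * T) * t ≤ c.length →
    trials (1 + (dvars F).length + k * T) (trialOf F k T) t c = true → runCoins F k T c = true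
  | 0, c, _, h => by simp at h
  | t + 1, c, hc, h => by
    set n' := (dvars F).length with hn'
    set B := 1 + n' + k * T with hB
    cases c with
    | nil => simp [hB, Nat.mul_succ] at hc
    | cons b c =>
      rw [trials_succ, Bool.or_eq_true] at h
      rw [runCoins_cons, Bool.or_eq_true]
      have hc' : n' + k * T ≤ c.length := by
        simp only [List.length_cons, hB, Nat.mul_succ] at hc; omega
      -- decompose `c = u ++ w` with `|u| = n'`
      obtain ⟨u, w, rfl, hu⟩ : ∃ u w, c = u ++ w ∧ u.length = n' :=
        ⟨c.take n', c.drop n', (List.take_append_drop n' c).symm, List.length_take_of_le (by omega)⟩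
      rw [initAssg_eq F hu] at ⊢
      rcases h with h | h
      · left
        have htake : (b :: (u ++ w)).take B = b :: (u ++ w.take (k * T)) := by
          rw [hB, show 1 + n' + k * T = (n' + k * T) + 1 by ring, List.take_succ_cons,
            List.take_append, List.take_of_length_le (show u.length ≤ n' + k * T by omega), hu,
            show n' + k * T - n' = k * T by omega]
        rw [htake, trialOf, initAssg_eq F hu, walkFound_take] at h
        exact h
      · right
        have hdrop : (b :: (u ++ w)).drop B = w.drop (k * T) := by
          rw [hB, show 1 + n' + k * T = (n' + k * T) + 1 by ring, List.drop_succ_cons,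
            ← List.drop_drop, List.drop_left' hu]
        rw [hdrop] at h
        refine runCoins_of_trials t _ ?_ h
        rw [← hn']
        simp only [List.length_drop, List.length_cons, List.length_append, hu, hB, Nat.mul_succ] at hc ⊢
        omega

/-- **The success probability of Schöning's algorithm** (Fomin–Kratsch 2010, Theorem 8.3 /
Schöning 1999): if `F` is satisfiable, its clauses have width `≤ k` (`k ≥ 3`) and `n'`
distinct variables, the walks have `T ≥ 6 · 2^k (n'+1) + 2` steps and the coin string holds
`t ≥ 4 (2 - 2/k)^{n'}` complete blocks of `1 + n' + k T` coins, then `runCoins` succeeds with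
probability `> 2/3`. [cite: FominKratsch2010, Theorem 8.3] -/
theorem runCoins_prob {T : ℕ} (hT : 6 * 2 ^ k * ((dvars F).length + 1) + 2 ≤ T) {t : ℕ}
    (ht : 4 * (2 - 2 / (k : ℝ)) ^ (dvars F).length ≤ t) {m : ℕ}
    (hm : (1 + (dvars F).length + k * T) * t ≤ m) :
    2 / 3 < uniformAvg m (fun c => ind (runCoins F k T c)) := by
  set n' := (dvars F).length with hn'
  set B := 1 + n' + k * T with hB
  obtain ⟨T', rfl⟩ : ∃ T', T = T' + 1 := ⟨T - 1, by omega⟩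
  -- one trial succeeds with probability `≥ p`
  set p : ℝ := (1 / (2 - 2 / (k : ℝ))) ^ n' / 2 with hp
  have hk' : (3 : ℝ) ≤ k := by exact_mod_cast hk
  have h22 : (0 : ℝ) < 2 - 2 / k := by
    have : (2 : ℝ) / k ≤ 1 := by rw [div_le_one (by linarith)]; linarith
    linarith
  have hp_le : p ≤ uniformAvg B (fun c => ind (trialOf F k (T' + 1) c)) := by
    rw [hB, show 1 + n' + k * (T' + 1) = 1 + (n' + k * (T' + 1)) by ring, uniformAvg_append]
    have e : (fun u : List Bool => uniformAvg (n' + k * (T' + 1)) (fun w => ind (trialOf F k (T' + 1) (u ++ w)))) =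
        fun u => if u.length = 1 then uniformAvg (n' + k * (T' + 1)) (fun w =>
          ind (walkFound F k (T' + 1) (initAssg F w).1 (initAssg F w).2)) else
          uniformAvg (n' + k * (T' + 1)) (fun w => ind (trialOf F k (T' + 1) (u ++ w))) := by
      funext u
      split_ifs with hu
      · match u, hu with
        | [b], _ => rfl
      · rfl
    rw [e]
    rw [show uniformAvg 1 (fun u : List Bool => if u.length = 1 then uniformAvg (n' + k * (T' + 1)) (fun w =>
          ind (walkFound F k (T' + 1) (initAssg F w).1 (initAssg F w).2)) else
          uniformAvg (n' + k * (T' + 1)) (fun w => ind (trialOf F k (T' + 1) (u ++ w)))) =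
        uniformAvg (n' + k * (T' + 1)) (fun w =>
          ind (walkFound F k (T' + 1) (initAssg F w).1 (initAssg F w).2)) from by
      rw [uniformAvg_succ, uniformAvg_zero, uniformAvg_zero]; simp]
    exact walk_prob hsat hwidth hk (by rw [← hn']; omega)
  have hp1 : p ≤ 1 := hp_le.trans (uniformAvg_le_one fun _ _ => ind_le_one _)
  have hpt : 2 ≤ p * t := by
    have h1 : p * (4 * (2 - 2 / (k : ℝ)) ^ n') = 2 := by
      have hinv : (1 / (2 - 2 / (k : ℝ))) ^ n' * (2 - 2 / (k : ℝ)) ^ n' = 1 := by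
        rw [← mul_pow, one_div_mul_cancel h22.ne', one_pow]
      calc p * (4 * (2 - 2 / (k : ℝ)) ^ n')
          = 2 * ((1 / (2 - 2 / (k : ℝ))) ^ n' * (2 - 2 / (k : ℝ)) ^ n') := by rw [hp]; ring
        _ = 2 := by rw [hinv, mul_one]
    have hp0 : 0 ≤ p := by rw [hp]; positivity
    calc (2 : ℝ) = p * (4 * (2 - 2 / (k : ℝ)) ^ n') := h1.symm
      _ ≤ p * t := mul_le_mul_of_nonneg_left ht hp0
  -- `t` trials on disjoint blocks
  have hfail := uniformAvg_trialsFail_le hp_le t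
  have hthird := one_sub_pow_le_third hp1 hpt
  -- `runCoins` dominates `trials` on strings of length `m ≥ B t`
  obtain ⟨e, rfl⟩ : ∃ e, m = B * t + e := ⟨m - B * t, (Nat.add_sub_cancel' hm).symm⟩
  have hdom : uniformAvg (B * t + e) (fun c => ind (trials B (trialOf F k (T' + 1)) t c)) ≤
      uniformAvg (B * t + e) (fun c => ind (runCoins F k (T' + 1) c)) :=
    uniformAvg_mono fun c hc => ind_le_ind fun h => runCoins_of_trials t c (by rw [hc, hB]; omega) h
  refine lt_of_lt_of_le ?_ hdom
  rw [uniformAvg_append]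
  have e2 : (fun u : List Bool => uniformAvg e (fun w => ind (trials B (trialOf F k (T' + 1)) t (u ++ w)))) =
      fun u => if u.length = B * t then ind (trials B (trialOf F k (T' + 1)) t u) else
        uniformAvg e (fun w => ind (trials B (trialOf F k (T' + 1)) t (u ++ w))) := by
    funext u
    split_ifs with hu
    · rw [show (fun w => ind (trials B (trialOf F k (T' + 1)) t (u ++ w))) =
          fun _ => ind (trials B (trialOf F k (T' + 1)) t u) from
        funext fun w => by rw [trials_append B _ t u w hu], uniformAvg_const]
    · rfl
  rw [e2, uniformAvg_congr_length (g := fun u => ind (trials B (trialOf F k (T' + 1)) t u))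
    (fun u hu => by rw [if_pos hu])]
  have e3 : uniformAvg (B * t) (fun u => ind (trials B (trialOf F k (T' + 1)) t u)) =
      1 - uniformAvg (B * t) (fun u => ind (!trials B (trialOf F k (T' + 1)) t u)) := by
    rw [← uniformAvg_const (B * t) 1, ← uniformAvg_sub]
    exact congrArg _ (funext fun u => by rw [ind_not]; ring)
  rw [e3]
  linarith

end Prob

end Literature.Computability.FineGrained.Schoening
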